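import Literature.Probability.LatticeModels.IsingModel
import HarnessLib

/-!
# Two replicas of the free zero-field Ising model: the duplicated-variables change of variables

Route `FKParityRobustness`, crux `StrandShadow` (stmt-CriticalPhenomena-14626), line `Sketch`
(replica-sponge-shadow).  Infrastructure for the stub `stub_replicaIdentities`
(`FKParityRobustnessStrandShadowReplicaIdentities.lean`): exact finite identities, valid on every
finite simple graph `G` and for every real `β`.

For a full configuration `σ : V → ℤˣ` the free zero-field Boltzmann weight of the volume `Λ` is
`exp (β ∑_{e ∈ ℰ_Λ} σ_e)` (`isingWeight_free_zero_eq`), and it only reads the spins inside `Λ`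
(`sum_bondSpin_congr`).  Two independent replicas `σ, σ'` on the whole graph are re-parametrised
by `(σ, A)`, `A = {v | σ_v = σ'_v}` the agreement set (the "sponge"), i.e.
`σ' = (v ↦ if v ∈ A then σ_v else -σ_v)` (`sum_sum_eq_sum_sum_flipOff`).  The product of the two
weights at `β` is the weight at `2β` of the decoupled system `ℰ_A ⊔ ℰ_{Aᶜ}`
(`exp_mul_exp_flipOff`: an edge inside `A` or inside `Aᶜ` counts twice, an edge across counts
zero), and a sum over full configurations splits along `V = A ⊔ Aᶜ` through the two gluing maps
(`sum_pi_eq_sum_sum_glue`).  The outcome is the master identity `sponge_sum_eq`: for all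
`B C : Finset V`,

  `∑_{σ,σ'} w_β(σ) w_β(σ') ∏_{x ∈ B} (σ_x + σ'_x)/2 ∏_{x ∈ C} (σ_x - σ'_x)/2
     = ∑_A 1[B ⊆ A ∧ C ⊆ Aᶜ] · N_{A,2β}(B) · N_{Aᶜ,2β}(C)`,

where `N_{Λ,β'}(B) = ∑_τ w_{Λ,β'}(τ) σ_B(glue τ) = Z^free_{Λ;β'} ⟨σ_B⟩^free_{Λ;β'}` is the
Boltzmann numerator of the tree's finite-volume free state (`isingCorr_mul_partitionFunction`).
Also recorded: the whole-graph free state as a sum over full configurations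
(`isingPartitionFunction_univ_eq`, `isingCorr_univ_eq`).

References: J. L. Lebowitz, Comm. Math. Phys. 35 (1974) 87–92 (duplicated spin variables);
M. Aizenman, Comm. Math. Phys. 86 (1982) 1–48, §§3–5 [AizenmanCMP1982].  Theorem-only file.
-/

noncomputable section

open Finset SimpleGraph
open Literature.Probability.LatticeModels

namespace Summit.CriticalPhenomena.Ising3DConformalLimit.Theorems.StrandShadowSketch

open scoped Classical

variable {V : Type} [Fintype V] [DecidableEq V] (G : SimpleGraph V) [DecidableRel G.Adj]

/-! ## The free zero-field Boltzmann weight and numerators -/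

/-- The free zero-field Boltzmann weight of `τ : Λ → ℤˣ` is `exp (β ∑_{e ∈ ℰ_Λ} σ_e(glue τ))`. -/
theorem isingWeight_free_zero_eq (Λ : Finset V) (β : ℝ) (τ : Λ → ℤˣ) :
    isingWeight G Λ β 0 .free τ =
      Real.exp (β * ∑ e ∈ edgesIn G Λ, bondSpin (glue Λ τ .free) e) := by
  simp only [isingWeight, isingHamiltonian, interactionEdges_free, zero_mul, sub_zero,
    neg_mul_neg]

/-- `⟨σ_B⟩ · Z = ∑_τ w(τ) σ_B(glue τ)`: the correlation times the partition function is the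
Boltzmann numerator (any field and boundary condition). -/
theorem isingCorr_mul_partitionFunction (Λ : Finset V) (β h : ℝ) (bc : BoundaryCondition V)
    (B : Finset V) :
    isingCorr G Λ β h bc B * isingPartitionFunction G Λ β h bc =
      ∑ τ : Λ → ℤˣ, isingWeight G Λ β h bc τ * spinProduct B (glue Λ τ bc) := by
  rw [isingCorr, isingExpect, integral_isingMeasure G Λ β h bc (measurable_spinProduct B)]
  exact div_mul_cancel₀ _ (isingPartitionFunction_pos G Λ β h bc).ne'

/-! ## Locality -/

/-- The interaction energy of the volume `Λ` only reads the spins inside `Λ`. -/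
theorem sum_bondSpin_congr (Λ : Finset V) {σ σ' : V → ℤˣ} (h : ∀ x ∈ Λ, σ x = σ' x) :
    ∑ e ∈ edgesIn G Λ, bondSpin σ e = ∑ e ∈ edgesIn G Λ, bondSpin σ' e := by
  refine Finset.sum_congr rfl fun e he => ?_
  rw [mem_edgesIn_iff] at he
  induction e using Sym2.ind with
  | _ x y =>
    have hx := h x (he.2 x (Sym2.mem_mk_left x y))
    have hy := h y (he.2 y (Sym2.mem_mk_right x y))
    simp only [bondSpin_mk, spinAt, hx, hy]

omit [Fintype V] [DecidableEq V] in
/-- The spin product `σ_B` only reads the spins inside `B`. -/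
theorem spinProduct_congr {B : Finset V} {σ σ' : V → ℤˣ} (h : ∀ x ∈ B, σ x = σ' x) :
    spinProduct B σ = spinProduct B σ' :=
  Finset.prod_congr rfl fun x hx => by simp only [spinAt, h x hx]

/-! ## Splitting and gluing full configurations -/

/-- A sum over full configurations splits along `V = A ⊔ Aᶜ` into a double sum over the finite
configurations of `A` and of `Aᶜ`, recombined by the obvious gluing. -/
theorem sum_pi_eq_sum_sum_glue (A : Finset V) (F : (V → ℤˣ) → ℝ) :
    ∑ σ : V → ℤˣ, F σ = ∑ τ : A → ℤˣ, ∑ τ' : ↥Aᶜ → ℤˣ,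
      F (fun x => if hx : x ∈ A then τ ⟨x, hx⟩ else τ' ⟨x, Finset.mem_compl.2 hx⟩) := by
  rw [← Fintype.sum_prod_type']
  let e : ((A → ℤˣ) × (↥Aᶜ → ℤˣ)) ≃ (V → ℤˣ) :=
    { toFun := fun p x => if hx : x ∈ A then p.1 ⟨x, hx⟩ else p.2 ⟨x, Finset.mem_compl.2 hx⟩
      invFun := fun σ => (fun x => σ x, fun x => σ x)
      left_inv := by
        rintro ⟨τ, τ'⟩
        refine Prod.ext (funext fun x => ?_) (funext fun x => ?_)
        · simp [x.2]
        · have hx : (x : V) ∉ A := Finset.mem_compl.1 x.2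
          simp [hx]
      right_inv := fun σ => funext fun x => by
        by_cases hx : x ∈ A <;> simp [hx] }
  exact (Fintype.sum_equiv e _ _ fun p => rfl).symm

/-- On the whole graph the gluing map is a bijection: a Boltzmann sum over `univ → ℤˣ` is a sum
over full configurations. -/
theorem sum_glue_univ (F : (V → ℤˣ) → ℝ) :
    ∑ τ : ↥(univ : Finset V) → ℤˣ, F (glue univ τ .free) = ∑ σ : V → ℤˣ, F σ := by
  refine Fintype.sum_bijective (fun τ => glue univ τ .free)
    ⟨glue_injective _ _, fun σ => ⟨fun x => σ x, funext fun x => ?_⟩⟩ _ _ fun τ => rfl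
  exact glue_apply_of_mem _ _ _ (mem_univ x)

/-- The whole-graph free zero-field partition function as a sum over full configurations:
`Z = ∑_σ exp (β ∑_{e ∈ ℰ} σ_e)`. -/
theorem isingPartitionFunction_univ_eq (β : ℝ) :
    isingPartitionFunction G univ β 0 .free =
      ∑ σ : V → ℤˣ, Real.exp (β * ∑ e ∈ edgesIn G univ, bondSpin σ e) := by
  rw [isingPartitionFunction]
  simp_rw [isingWeight_free_zero_eq]
  exact sum_glue_univ (fun σ => Real.exp (β * ∑ e ∈ edgesIn G univ, bondSpin σ e))

/-- The whole-graph free zero-field correlation as a ratio of sums over full configurations: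
`⟨σ_B⟩ = (∑_σ exp (β ∑_e σ_e) σ_B) / ∑_σ exp (β ∑_e σ_e)`. -/
theorem isingCorr_univ_eq (β : ℝ) (B : Finset V) :
    isingCorr G univ β 0 .free B =
      (∑ σ : V → ℤˣ, Real.exp (β * ∑ e ∈ edgesIn G univ, bondSpin σ e) * spinProduct B σ) /
        ∑ σ : V → ℤˣ, Real.exp (β * ∑ e ∈ edgesIn G univ, bondSpin σ e) := by
  rw [isingCorr, isingExpect, integral_isingMeasure G univ β 0 .free (measurable_spinProduct B),
    isingPartitionFunction_univ_eq]
  simp_rw [isingWeight_free_zero_eq]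
  rw [sum_glue_univ (fun σ => Real.exp (β * ∑ e ∈ edgesIn G univ, bondSpin σ e) *
    spinProduct B σ)]

/-! ## The change of variables `(σ, σ') ↔ (σ, A)` -/

/-- **Duplicated variables.** For fixed `σ`, `A ↦ (v ↦ if v ∈ A then σ_v else -σ_v)` is a
bijection from `Finset V` onto the full configurations (inverse: the agreement set
`{v | σ_v = σ'_v}`), so a double replica sum is a sum over `(σ, A)`. -/
theorem sum_sum_eq_sum_sum_flipOff (g : (V → ℤˣ) → (V → ℤˣ) → ℝ) :
    ∑ σ : V → ℤˣ, ∑ σ' : V → ℤˣ, g σ σ' =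
      ∑ σ : V → ℤˣ, ∑ A : Finset V, g σ (fun v => if v ∈ A then σ v else -σ v) := by
  refine Finset.sum_congr rfl fun σ _ => ?_
  symm
  refine Fintype.sum_bijective (fun A : Finset V => fun v => if v ∈ A then σ v else -σ v)
    ⟨?_, ?_⟩ _ _ fun A => rfl
  · intro A B hAB
    ext v
    have hv := congr_fun hAB v
    by_cases hA : v ∈ A <;> by_cases hB : v ∈ B
    · simp [hA, hB]
    · simp only [hA, hB, if_true, if_false] at hv
      exact absurd hv (units_ne_neg_self _)
    · simp only [hA, hB, if_true, if_false] at hv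
      exact absurd hv.symm (units_ne_neg_self _)
    · simp [hA, hB]
  · intro σ'
    refine ⟨univ.filter fun v => σ v = σ' v, funext fun v => ?_⟩
    by_cases hv : σ v = σ' v
    · simp [hv]
    · have hv' : σ v = -σ' v := Int.units_ne_iff_eq_neg.1 hv
      simp [hv']

omit [Fintype V] in
/-- The spins of the flipped-off configuration. -/
theorem spinAt_flipOff (A : Finset V) (σ : V → ℤˣ) (x : V) :
    spinAt x (fun v => if v ∈ A then σ v else -σ v) =
      if x ∈ A then spinAt x σ else -spinAt x σ := by
  by_cases hx : x ∈ A <;> simp [spinAt, hx, Units.val_neg]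

/-- The energy bookkeeping of the change of variables: an edge inside `A` or inside `Aᶜ`
contributes `σ_e` to both replicas, an edge between `A` and `Aᶜ` contributes `σ_e - σ_e = 0`. -/
theorem sum_bondSpin_add_sum_bondSpin_flipOff (A : Finset V) (σ : V → ℤˣ) :
    ∑ e ∈ edgesIn G univ, bondSpin σ e +
        ∑ e ∈ edgesIn G univ, bondSpin (fun v => if v ∈ A then σ v else -σ v) e =
      2 * ∑ e ∈ edgesIn G A, bondSpin σ e + 2 * ∑ e ∈ edgesIn G Aᶜ, bondSpin σ e := by
  have hA : edgesIn G A = (edgesIn G univ).filter (fun e => ∀ x ∈ e, x ∈ A) := by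
    ext e; simp [mem_edgesIn_iff]
  have hAc : edgesIn G Aᶜ = (edgesIn G univ).filter (fun e => ∀ x ∈ e, x ∉ A) := by
    ext e; simp [mem_edgesIn_iff]
  rw [hA, hAc, Finset.sum_filter, Finset.sum_filter, Finset.mul_sum, Finset.mul_sum,
    ← Finset.sum_add_distrib, ← Finset.sum_add_distrib]
  refine Finset.sum_congr rfl fun e _ => ?_
  induction e using Sym2.ind with
  | _ x y =>
    simp only [bondSpin_mk, spinAt_flipOff, Sym2.mem_iff, forall_eq_or_imp, forall_eq]
    by_cases hx : x ∈ A <;> by_cases hy : y ∈ A <;> simp [hx, hy] <;> ring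

/-- **The product of the two replica weights at `β` is the decoupled weight at `2β`**:
`w_β(σ) w_β(σ') = exp (2β ∑_{ℰ_A} σ_e) · exp (2β ∑_{ℰ_{Aᶜ}} σ_e)` for `σ' = flipOff A σ`. -/
theorem exp_mul_exp_flipOff (β : ℝ) (A : Finset V) (σ : V → ℤˣ) :
    Real.exp (β * ∑ e ∈ edgesIn G univ, bondSpin σ e) *
        Real.exp (β * ∑ e ∈ edgesIn G univ, bondSpin (fun v => if v ∈ A then σ v else -σ v) e) =
      Real.exp (2 * β * ∑ e ∈ edgesIn G A, bondSpin σ e) *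
        Real.exp (2 * β * ∑ e ∈ edgesIn G Aᶜ, bondSpin σ e) := by
  rw [← Real.exp_add, ← Real.exp_add, ← mul_add, sum_bondSpin_add_sum_bondSpin_flipOff]
  congr 1
  ring

omit [Fintype V] in
/-- `∏_{x ∈ B} 1[x ∈ A] f x = 1[B ⊆ A] ∏_{x ∈ B} f x`. -/
theorem prod_ite_mem_zero (B A : Finset V) (f : V → ℝ) :
    ∏ x ∈ B, (if x ∈ A then f x else 0) = if B ⊆ A then ∏ x ∈ B, f x else 0 := by
  split_ifs with h
  · exact Finset.prod_congr rfl fun x hx => if_pos (h hx)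
  · obtain ⟨x, hxB, hxA⟩ := Finset.not_subset.1 h
    exact Finset.prod_eq_zero hxB (if_neg hxA)

/-! ## The master identity -/

/-- **Master two-replica identity (Lebowitz duplicated variables, sponge form).** For all finite
`B, C`, the two-replica expectation numerator of `∏_{x∈B} (σ_x+σ'_x)/2 · ∏_{x∈C} (σ_x-σ'_x)/2`
equals the sponge sum `∑_A 1[B ⊆ A ∧ C ⊆ Aᶜ] N_{A,2β}(B) N_{Aᶜ,2β}(C)` of products of free
Boltzmann numerators at doubled inverse temperature on the agreement set and on its complement. -/
theorem sponge_sum_eq (β : ℝ) (B C : Finset V) :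
    ∑ σ : V → ℤˣ, ∑ σ' : V → ℤˣ,
        Real.exp (β * ∑ e ∈ edgesIn G univ, bondSpin σ e) *
          Real.exp (β * ∑ e ∈ edgesIn G univ, bondSpin σ' e) *
          ((∏ x ∈ B, (spinAt x σ + spinAt x σ') / 2) * ∏ x ∈ C, (spinAt x σ - spinAt x σ') / 2) =
      ∑ A : Finset V, if B ⊆ A ∧ C ⊆ Aᶜ then
        (∑ τ : A → ℤˣ, isingWeight G A (2 * β) 0 .free τ * spinProduct B (glue A τ .free)) *
          ∑ τ : ↥Aᶜ → ℤˣ, isingWeight G Aᶜ (2 * β) 0 .free τ * spinProduct C (glue Aᶜ τ .free)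
      else 0 := by
  rw [sum_sum_eq_sum_sum_flipOff, Finset.sum_comm]
  refine Finset.sum_congr rfl fun A _ => ?_
  have hB : ∀ σ : V → ℤˣ,
      ∏ x ∈ B, (spinAt x σ + spinAt x (fun v => if v ∈ A then σ v else -σ v)) / 2 =
        if B ⊆ A then spinProduct B σ else 0 := by
    intro σ
    rw [spinProduct, ← prod_ite_mem_zero]
    refine Finset.prod_congr rfl fun x _ => ?_
    rw [spinAt_flipOff]
    split_ifs <;> ring
  have hC : ∀ σ : V → ℤˣ,
      ∏ x ∈ C, (spinAt x σ - spinAt x (fun v => if v ∈ A then σ v else -σ v)) / 2 =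
        if C ⊆ Aᶜ then spinProduct C σ else 0 := by
    intro σ
    rw [spinProduct, ← prod_ite_mem_zero]
    refine Finset.prod_congr rfl fun x _ => ?_
    rw [spinAt_flipOff]
    by_cases hx : x ∈ A
    · simp [hx]
    · simp only [hx, if_false, Finset.mem_compl, not_false_eq_true, if_true]
      ring
  simp only [exp_mul_exp_flipOff, hB, hC]
  by_cases hBA : B ⊆ A
  · by_cases hCA : C ⊆ Aᶜ
    · simp only [hBA, hCA, and_self, if_true]
      rw [Finset.sum_mul_sum, sum_pi_eq_sum_sum_glue A]
      refine Finset.sum_congr rfl fun τ _ => Finset.sum_congr rfl fun τ' _ => ?_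
      have hAg : ∀ x ∈ A, glue A τ .free x =
          (fun x => if hx : x ∈ A then τ ⟨x, hx⟩ else τ' ⟨x, Finset.mem_compl.2 hx⟩) x := by
        intro x hx
        simp [hx]
      have hAcg : ∀ x ∈ Aᶜ, glue Aᶜ τ' .free x =
          (fun x => if hx : x ∈ A then τ ⟨x, hx⟩ else τ' ⟨x, Finset.mem_compl.2 hx⟩) x := by
        intro x hx
        have hx' : x ∉ A := Finset.mem_compl.1 hx
        simp [hx, hx']
      rw [isingWeight_free_zero_eq, isingWeight_free_zero_eq, sum_bondSpin_congr G A hAg,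
        sum_bondSpin_congr G Aᶜ hAcg, spinProduct_congr fun x hx => hAg x (hBA hx),
        spinProduct_congr fun x hx => hAcg x (hCA hx)]
      ring
    · simp [hBA, hCA]
  · simp [hBA]

end Summit.CriticalPhenomena.Ising3DConformalLimit.Theorems.StrandShadowSketch

end
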